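import Literature.Geometry.Symplectic.ComplexStructureOrientation
import Literature.Geometry.Symplectic.SteinJBundle
import Literature.Topology.FourManifolds.SmoothOrientation
import HarnessLib

/-!
# The complex orientation of a Stein domain (every Stein domain is orientable)

Topic `Literature/Geometry/Symplectic`.  A Stein structure (`SteinStructure W`,
`SteinDomain.lean`) carries an almost complex structure `J`; as every almost complex manifold,
`W` is then canonically oriented by the complex orientation of its tangent spaces (the class
of the `J`-adapted bases `(v, Jv, w, Jw)`, `ComplexStructureOrientation.lean`).  Akbulut–Matveyev
(1998) use this orientation throughout (*"`X̃₁` and `-X̃₂` are PC manifolds"*, the sign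
referring to the complex orientation), and the named facts TUBE
(`exists_handleAttachingMap_of_isKnotFraming`) and the derivation
`AkbulutMatveyev1998_defectZero_of_facts` carry an orientability hypothesis that this file
discharges for Stein domains:

* `coordChangeEquiv x y` — the tangent coordinate change `tangentCoordChange I y x y` as a linear
  isomorphism of the model space, for `y` in the chart domain of `x`;
* `conj_coordChangeEquiv_J` — the matrix `JTriv J x y` of `J_y` in the trivialization at `x`
  (`SteinJBundle.lean`) *is* the conjugate `T J_y T⁻¹` of `J_y` by that isomorphism;
* `complexSmoothOrientation J` — **the complex orientation is a smooth orientation**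
  (`Literature.Topology.FourManifolds.SmoothOrientation`): local constancy in the sense of that
  structure follows from the naturality of the complex orientation
  (`ComplexStructure.map_orientation`), its local constancy in `J`
  (`ComplexStructure.eventually_orientation_eq`) and the continuity of `y ↦ JTriv J x y`
  (`continuousOn_JTriv`), via `Orientation.map_eq_iff_det_pos`;
* `SteinStructure.complexOrientation`, `SteinStructure.isOrientable`,
  `IsSteinDomain.isOrientable` — **every Stein domain is orientable**.

## References

* K. Cieliebak, Ya. Eliashberg, *From Stein to Weinstein and back*, AMS Coll. Publ. 59 (2012),
  Ch. 2 (almost complex manifolds are oriented). [CieliebakEliashberg2012]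
* S. Akbulut, R. Matveyev, IMRN 1998, §1, §4 (`-X̃₂`). [AkbulutMatveyev1998]
* M. W. Hirsch, *Differential Topology*, GTM 33 (1976), §4.4. [HirschDT1976]
-/

noncomputable section

open scoped Manifold ContDiff Topology Bundle
open Set Function Bundle Filter Module

namespace Literature.Geometry.Symplectic

open Literature.Topology.FourManifolds

/-- The model vector space `ℝ⁴` of the tangent spaces. [folklore] -/
local notation "E4" => EuclideanSpace ℝ (Fin 4)

/-- `dim ℝ⁴ = 4`. [folklore] -/
theorem finrank_E4 : finrank ℝ E4 = 4 := finrank_euclideanSpace_fin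

/-- `card (Fin 4) = dim ℝ⁴` (the index hypothesis of `Orientation.map_eq_iff_det_pos`).
[folklore] -/
theorem card_fin_four_eq_finrank_E4 : Fintype.card (Fin 4) = finrank ℝ E4 := by
  rw [finrank_E4, Fintype.card_fin]

variable {W : Type*} [TopologicalSpace W] [ChartedSpace (EuclideanHalfSpace 4) W]
  [IsManifold (𝓡∂ 4) ∞ W]

/-! ### The tangent coordinate change as a linear isomorphism -/

/-- **The tangent coordinate change `T_yW →` (chart at `y`) `→` (chart at `x`) as a linear
isomorphism of the model space**, for `y` in the chart domain of `x`: `tangentCoordChange I y x y`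
with inverse `tangentCoordChange I x y y` (cocycle `tangentCoordChange_comp`). [folklore] -/
def coordChangeEquiv (x y : W) (hy : y ∈ (extChartAt (𝓡∂ 4) x).source) : E4 ≃ₗ[ℝ] E4 :=
  LinearEquiv.ofLinear
    ((tangentCoordChange (𝓡∂ 4) y x y : E4 →L[ℝ] E4) : E4 →ₗ[ℝ] E4)
    ((tangentCoordChange (𝓡∂ 4) x y y : E4 →L[ℝ] E4) : E4 →ₗ[ℝ] E4)
    (LinearMap.ext fun v => by
      show tangentCoordChange (𝓡∂ 4) y x y (tangentCoordChange (𝓡∂ 4) x y y v) = v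
      rw [tangentCoordChange_comp ⟨⟨hy, mem_extChartAt_source y⟩, hy⟩,
        tangentCoordChange_self hy])
    (LinearMap.ext fun v => by
      show tangentCoordChange (𝓡∂ 4) x y y (tangentCoordChange (𝓡∂ 4) y x y v) = v
      rw [tangentCoordChange_comp ⟨⟨mem_extChartAt_source y, hy⟩, mem_extChartAt_source y⟩,
        tangentCoordChange_self (mem_extChartAt_source y)])

/-- `coordChangeEquiv x y v = tangentCoordChange I y x y v`. [folklore] -/
@[simp] theorem coordChangeEquiv_apply (x y : W) (hy : y ∈ (extChartAt (𝓡∂ 4) x).source) (v : E4) :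
    coordChangeEquiv x y hy v = tangentCoordChange (𝓡∂ 4) y x y v := rfl

/-- `(coordChangeEquiv x y)⁻¹ v = tangentCoordChange I x y y v`. [folklore] -/
@[simp] theorem coordChangeEquiv_symm_apply (x y : W) (hy : y ∈ (extChartAt (𝓡∂ 4) x).source)
    (v : E4) : (coordChangeEquiv x y hy).symm v = tangentCoordChange (𝓡∂ 4) x y y v := rfl

/-- The underlying linear map of `coordChangeEquiv x y` is `tangentCoordChange I y x y`. [folklore] -/
theorem coe_coordChangeEquiv (x y : W) (hy : y ∈ (extChartAt (𝓡∂ 4) x).source) :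
    (coordChangeEquiv x y hy : E4 →ₗ[ℝ] E4) =
      ((tangentCoordChange (𝓡∂ 4) y x y : E4 →L[ℝ] E4) : E4 →ₗ[ℝ] E4) := rfl

/-! ### The complex structures of the tangent spaces -/

omit [TopologicalSpace W] [ChartedSpace (EuclideanHalfSpace 4) W] [IsManifold (𝓡∂ 4) ∞ W] in
/-- The complex structure of `T_xW` (read in the chart at `x`) defined by a field of
endomorphisms `J` with `J² = -1`. [folklore] -/
def complexStructureOf (J : (x : W) → (E4 →L[ℝ] E4)) (hJ : ∀ x v, J x (J x v) = -v) (x : W) :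
    ComplexStructure E4 :=
  ⟨(J x : E4 →ₗ[ℝ] E4), hJ x⟩

omit [TopologicalSpace W] [ChartedSpace (EuclideanHalfSpace 4) W] [IsManifold (𝓡∂ 4) ∞ W] in
/-- Unfolding `complexStructureOf`. [folklore] -/
@[simp] theorem complexStructureOf_J (J : (x : W) → (E4 →L[ℝ] E4)) (hJ : ∀ x v, J x (J x v) = -v)
    (x : W) : (complexStructureOf J hJ x).J = (J x : E4 →ₗ[ℝ] E4) := rfl

/-- **`JTriv J x y` is the conjugate of `J_y` by the coordinate change**: the matrix of `J_y`
in the trivialization at `x` is `T J_y T⁻¹`, `T = coordChangeEquiv x y`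
(`TangentBundle.continuousLinearMapAt_trivializationAt_eq_core`,
`TangentBundle.symmL_trivializationAt_eq_core`). [folklore] -/
theorem conj_coordChangeEquiv_J (J : (x : W) → (E4 →L[ℝ] E4)) (hJ : ∀ x v, J x (J x v) = -v)
    {x y : W} (hy : y ∈ (extChartAt (𝓡∂ 4) x).source) :
    ((complexStructureOf J hJ y).conj (coordChangeEquiv x y hy)).J = (JTriv J x y : E4 →ₗ[ℝ] E4) := by
  have hy' : y ∈ (chartAt (EuclideanHalfSpace 4) x).source := by rwa [← extChartAt_source (𝓡∂ 4)]
  have h1 : ∀ w : E4, (trivializationAt E4 (TangentSpace (𝓡∂ 4)) x).continuousLinearMapAt ℝ y w =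
      tangentCoordChange (𝓡∂ 4) y x y w := fun w =>
    DFunLike.congr_fun (TangentBundle.continuousLinearMapAt_trivializationAt_eq_core hy') w
  have h2 : ∀ w : E4, (trivializationAt E4 (TangentSpace (𝓡∂ 4)) x).symmL ℝ y w =
      tangentCoordChange (𝓡∂ 4) x y y w := fun w =>
    DFunLike.congr_fun (TangentBundle.symmL_trivializationAt_eq_core hy') w
  refine LinearMap.ext fun v => ?_
  show tangentCoordChange (𝓡∂ 4) y x y (J y (tangentCoordChange (𝓡∂ 4) x y y v)) =
    (trivializationAt E4 (TangentSpace (𝓡∂ 4)) x).continuousLinearMapAt ℝ y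
      (J y ((trivializationAt E4 (TangentSpace (𝓡∂ 4)) x).symmL ℝ y v))
  rw [h1, h2]

/-- `JTriv J x x = J_x` (the trivialization at `x` is the identity on `T_xW`). [folklore] -/
theorem JTriv_self (J : (x : W) → (E4 →L[ℝ] E4)) (x : W) : JTriv J x x = J x := by
  have hx : x ∈ (chartAt (EuclideanHalfSpace 4) x).source := mem_chart_source _ x
  have h1 : ∀ w : E4, (trivializationAt E4 (TangentSpace (𝓡∂ 4)) x).continuousLinearMapAt ℝ x w =
      tangentCoordChange (𝓡∂ 4) x x x w := fun w =>
    DFunLike.congr_fun (TangentBundle.continuousLinearMapAt_trivializationAt_eq_core hx) w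
  have h2 : ∀ w : E4, (trivializationAt E4 (TangentSpace (𝓡∂ 4)) x).symmL ℝ x w =
      tangentCoordChange (𝓡∂ 4) x x x w := fun w =>
    DFunLike.congr_fun (TangentBundle.symmL_trivializationAt_eq_core hx) w
  refine ContinuousLinearMap.ext fun v => ?_
  show (trivializationAt E4 (TangentSpace (𝓡∂ 4)) x).continuousLinearMapAt ℝ x
    (J x ((trivializationAt E4 (TangentSpace (𝓡∂ 4)) x).symmL ℝ x v)) = J x v
  rw [h1, h2, tangentCoordChange_self (mem_extChartAt_source x),
    tangentCoordChange_self (mem_extChartAt_source x)]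

/-! ### The complex orientation is a smooth orientation -/

variable [T2Space W]

/-- **The complex orientation of an almost complex `4`-manifold is a smooth orientation.**  At
`x` it is the complex orientation of `(T_xW, J_x)` (`ComplexStructure.orientation`, reindexed
to `Fin (dim ℝ⁴)`).  Local constancy: for `y` near `x` with coordinate change
`T = coordChangeEquiv x y`, `T_* (o y)` is the complex orientation of `T J_y T⁻¹ = JTriv J x y`
(`ComplexStructure.map_orientation`, `conj_coordChangeEquiv_J`), which by continuity of
`y ↦ JTriv J x y` (`continuousOn_JTriv`) and local constancy of the complex orientation in `J`
(`ComplexStructure.eventually_orientation_eq`) is `o x`; hence `o y = o x ↔ T_* (o y) = o y ↔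
det T > 0` (`Orientation.map_eq_iff_det_pos`). [cite: HirschDT1976, §4.4] -/
def complexSmoothOrientation (J : (x : W) → (E4 →L[ℝ] E4)) (hJ : ∀ x v, J x (J x v) = -v)
    (hJs : PreservesSmoothFields J) : SmoothOrientation (𝓡∂ 4) W where
  toFun x := Orientation.reindex ℝ E4 (finCongr finrank_E4.symm)
    ((complexStructureOf J hJ x).orientation finrank_E4)
  eventually_eq_iff' x := by
    -- continuity of `y ↦ JTriv J x y` at `x`, and `JTriv J x x = J x`
    have hcont : ContinuousAt (fun y => JTriv J x y) x := by
      have h : ContinuousOn (fun y => JTriv J x y) (chartAt (EuclideanHalfSpace 4) x).source :=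
        continuousOn_clm_apply.2 fun w => continuousOn_JTriv hJs x w
      exact h.continuousAt ((chartAt _ x).open_source.mem_nhds (mem_chart_source _ x))
    have hxx : ((JTriv J x x : E4 →L[ℝ] E4) : E4 →ₗ[ℝ] E4) = (complexStructureOf J hJ x).J := by
      rw [JTriv_self]; rfl
    have hev := hcont.eventually
      (ComplexStructure.eventually_orientation_eq finrank_E4 (complexStructureOf J hJ x)
        (JTriv J x x) hxx)
    filter_upwards [hev, (chartAt (EuclideanHalfSpace 4) x).open_source.mem_nhds
      (mem_chart_source _ x)] with y hy hyU
    have hys : y ∈ (extChartAt (𝓡∂ 4) x).source := by rwa [extChartAt_source]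
    -- `JTriv J x y = T J_y T⁻¹` is a complex structure with the orientation of `J_x`
    have hconj := conj_coordChangeEquiv_J J hJ hys
    have hsq : ∀ v, (JTriv J x y : E4 →ₗ[ℝ] E4) ((JTriv J x y : E4 →ₗ[ℝ] E4) v) = -v := fun v => by
      rw [← hconj]
      exact ((complexStructureOf J hJ y).conj (coordChangeEquiv x y hys)).J_sq v
    have hor := hy hsq
    -- `T_* (o y) = o x`
    have hmap : Orientation.map (Fin 4) (coordChangeEquiv x y hys)
        ((complexStructureOf J hJ y).orientation finrank_E4) =
        (complexStructureOf J hJ x).orientation finrank_E4 := by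
      rw [(complexStructureOf J hJ y).map_orientation finrank_E4 finrank_E4
        (coordChangeEquiv x y hys), ← hor]
      congr 1
      exact ComplexStructure.ext' hconj
    -- conclude
    rw [(Orientation.reindex ℝ E4 (finCongr finrank_E4.symm)).apply_eq_iff_eq, ← hmap, eq_comm,
      Orientation.map_eq_iff_det_pos _ _ card_fin_four_eq_finrank_E4, coe_coordChangeEquiv]

/-- Unfolding the complex orientation at a point. [folklore] -/
theorem complexSmoothOrientation_apply (J : (x : W) → (E4 →L[ℝ] E4))
    (hJ : ∀ x v, J x (J x v) = -v) (hJs : PreservesSmoothFields J) (x : W) :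
    complexSmoothOrientation J hJ hJs x = Orientation.reindex ℝ E4 (finCongr finrank_E4.symm)
      ((complexStructureOf J hJ x).orientation finrank_E4) := rfl

variable [CompactSpace W]

/-- **The complex orientation of a Stein domain.** [cite: AkbulutMatveyev1998, §1] -/
def SteinStructure.complexOrientation (S : SteinStructure W) : SmoothOrientation (𝓡∂ 4) W :=
  complexSmoothOrientation S.J S.J_sq S.preservesSmoothFields

/-- **A Stein domain is orientable** (by its complex orientation). [folklore] -/
theorem SteinStructure.isOrientable (S : SteinStructure W) : IsOrientable (𝓡∂ 4) W :=
  ⟨S.complexOrientation⟩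

/-- A Stein domain is orientable. [folklore] -/
theorem IsSteinDomain.isOrientable (h : IsSteinDomain W) : IsOrientable (𝓡∂ 4) W := by
  obtain ⟨S⟩ := h
  exact S.isOrientable

end Literature.Geometry.Symplectic

end
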